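import Mathlib
import Summits.Ventures.HodgeRepro.BallGenIsotropy

/-!
# Lemma W, algebraic core: a translate of a `1`-form escapes any proper subspace at a chosen point

Blind re-derivation cell `pub-hodge-repro`, seat `typer-2` (gen 3).  ROUTE.md v2.1 Appendix A4 (Lemma W): for a
non-zero pointwise-decomposable `i`-form `η = v₁ ∧ … ∧ v_i` (`i ≤ p − 1`) and a non-zero `1`-form `ω` on `𝔹^p`, some
`g ∈ U(p,1)` has `η ∧ g^*ω ≢ 0`.  Pointwise: at a point `z₁` where `v₁(z₁), …, v_i(z₁)` are linearly independent,
`η(z₁) ∧ u ≠ 0 ⟺ u ∉ span(v(z₁))`; so the claim is that the covectors `(γ^*ω)(z₁) = J_γ(z₁)ᵀ ω(γ z₁)`, `γ ∈ U(p,1)`,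
are not all inside the proper subspace `span(v(z₁))`.  PROOF (`exists_pullback_not_mem`): transitivity moves the centre
to `z₁` (`h`) and to a point `w` with `ω(w) ≠ 0` (`g₀`); for `γ = g₀ · rot A · h⁻¹` the chain rule gives
`(γ^*ω)(z₁) = J_{h⁻¹}(z₁)ᵀ · Aᵀ · u₀` with `u₀ = J_{g₀}(0)ᵀ ω(w) ≠ 0`; the unitary orbit of `u₀` is not contained in
the proper subspace pulled back along the invertible `J_{h⁻¹}(z₁)ᵀ` (orbit lemma).  No topology is used here; the
density step is `BallGenLemmaW.lean`.
-/

set_option autoImplicit false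

noncomputable section

namespace HodgeRepro.BallGen

open Matrix

variable {p : ℕ}

/-- The span of `i < p` linearly independent covectors is a proper subspace of `ℂ^p`. -/
theorem span_ne_top_of_linearIndependent {i : ℕ} (hi : i < p) {v : Fin i → Fin p → ℂ}
    (hv : LinearIndependent ℂ v) : Submodule.span ℂ (Set.range v) ≠ ⊤ := by
  intro h
  have h1 := finrank_span_eq_card hv
  rw [h, finrank_top, Module.finrank_fin_fun, Fintype.card_fin] at h1
  omega

/-- The pull-back of a proper subspace along an invertible matrix is proper. -/
theorem comap_mulVecLin_ne_top {M N : Matrix (Fin p) (Fin p) ℂ} (hMN : M * N = 1)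
    {V : Submodule ℂ (Fin p → ℂ)} (hV : V ≠ ⊤) : V.comap (Matrix.mulVecLin M) ≠ ⊤ := by
  intro h
  apply hV
  rw [eq_top_iff]
  intro y _
  have hy : N *ᵥ y ∈ V.comap (Matrix.mulVecLin M) := by rw [h]; trivial
  rw [Submodule.mem_comap, Matrix.mulVecLin_apply, Matrix.mulVec_mulVec, hMN, Matrix.one_mulVec] at hy
  exact hy

/-- **Lemma W, algebraic core.**  Let `v₁, …, v_i` (`i < p`) be linearly independent covectors at `z₁` and let `ω` be
a cotangent field with `ω(w) ≠ 0` at some point `w`.  Then some `γ ∈ U(p,1)` has `(γ^*ω)(z₁) ∉ span(v)`, i.e.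
`v₁ ∧ … ∧ v_i ∧ (γ^*ω)(z₁) ≠ 0`. -/
theorem exists_pullback_not_mem {i : ℕ} (hi : i < p) {v : Fin i → Fin p → ℂ} (hv : LinearIndependent ℂ v)
    (z₁ : Ball p) (ω : Ball p → Fin p → ℂ) {w : Ball p} (hω : ω w ≠ 0) :
    ∃ γ : U p, pullback γ ω z₁ ∉ Submodule.span ℂ (Set.range v) := by
  set V := Submodule.span ℂ (Set.range v) with hVdef
  have hV : V ≠ ⊤ := span_ne_top_of_linearIndependent hi hv
  set h := boost z₁ with hh
  set g₀ := boost w with hg₀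
  have hz : act h⁻¹ z₁ = center p := by
    have e := act_inv_act h (center p)
    rwa [hh, act_boost_center] at e
  set M := (Jac h⁻¹ z₁)ᵀ with hM
  set N := (Jac h⁻¹⁻¹ (act h⁻¹ z₁))ᵀ with hN
  have hMN : M * N = 1 := by
    rw [hM, hN, ← Matrix.transpose_mul, Jac_inv_mul, Matrix.transpose_one]
  have hV' := comap_mulVecLin_ne_top hMN hV
  set u₀ := (Jac g₀ (center p))ᵀ *ᵥ ω w with hu₀def
  have hu₀ : u₀ ≠ 0 := by
    intro h0
    apply hω
    apply Jac_transpose_mulVec_injective g₀ (center p)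
    simpa [Matrix.mulVec_zero] using h0
  obtain ⟨A, hA, hAu⟩ := exists_unitary_transpose_mulVec_not_mem hu₀ _ hV'
  refine ⟨g₀ * rot A hA * h⁻¹, ?_⟩
  have hact : act (g₀ * rot A hA * h⁻¹) z₁ = w := by
    rw [← act_mul, hz, act_mul_rot_center, hg₀, act_boost_center]
  have hJac : Jac (g₀ * rot A hA * h⁻¹) z₁ = (Jac g₀ (center p) * A) * Jac h⁻¹ z₁ := by
    rw [Jac_mul, hz, Jac_mul_rot_center]
  have hpull : pullback (g₀ * rot A hA * h⁻¹) ω z₁ = M *ᵥ (Aᵀ *ᵥ u₀) := by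
    rw [pullback, hact, hJac, Matrix.transpose_mul, Matrix.transpose_mul, ← Matrix.mulVec_mulVec,
      ← Matrix.mulVec_mulVec]
  rw [hpull]
  intro hmem
  apply hAu
  rw [Submodule.mem_comap, Matrix.mulVecLin_apply]
  exact hmem

end HodgeRepro.BallGen

end
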